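import Mathlib
import Summits.AtomisticToContinuum.FouriersLaw.Theses.BondHeatUncertainty
import Summits.AtomisticToContinuum.FouriersLaw.Theses.FeketeSeriesLaw
import Summits.AtomisticToContinuum.FouriersLaw.Theses.JunctionLocality

/-!
# Route `BondHeatUncertainty` — the import slot `PositiveOrInfiniteLimit` from the series laws for the resistance

Support for item `stmt-AtomisticToContinuum-9128`
(`Summit.AtomisticToContinuum.FouriersLaw.Theses.BondHeatUncertainty.PositiveOrInfiniteLimit`, the IMPORT SLOT
of route `BondHeatUncertainty`): under weak-NESS uniqueness, along every steady-state family of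
`pinnedChain ω₂ lam β γ` and every `T > 0`, the finite-length response coefficients `D N` converge in `EReal`
to some `ℓ ∈ (0, +∞]` ("not insulating + no oscillation").  Unconditionally this is the positivity-and-
convergence half of Fourier's law for a deterministic anharmonic bulk (open; BLR 2000 §6.3).  The route text
names the Fekete engines of the sibling routes as suppliers; this file lands BOTH supply lines, sorry-free, as
reductions to OPEN cruxes of the open routes `FeketeSeriesLaw` and `JunctionLocality`, BY NAME:

* `iterate_subadditive_two`, `div_le_add_div_of_subadditive_two`, `tendsto_div_of_quasiSubadditive_two` —
  FEKETE'S LEMMA WITH AN ADDITIVE DEFECT ON THE INDEX SEMIGROUP `{n ≥ 2}` (pure real analysis):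
  `a (n+m) ≤ a n + a m + C` (`n, m ≥ 2`) and `a n ≥ 0` (`n ≥ 2`) give `a n / n → ℓ ≥ 0`
  (`ℓ = inf_{n ≥ 2} (a n + C)/n`).  (= the content of `FeketeSeriesLaw.FeketeGlue`, item 14042, with `0 ≤ ℓ`.)
* `ereal_tendsto_of_tendsto_resistance_div` — the common `EReal` step: if `D N > 0` (`N ≥ 2`) and
  `R N / N → ℓ ≥ 0` for the resistances `R N = (N-1)/D N`, then `D N = ((N-1)/N)/(R N/N)` converges in
  `EReal` to `1/ℓ ∈ (0,∞)` if `ℓ > 0` and to `⊤` if `ℓ = 0` (`EReal.tendsto_nhds_top_iff_real`).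
* `ereal_tendsto_of_quasiSubadditive_resistance` — SUBADDITIVE line (abstract `D`): positivity + the series
  law with bounded junction defect `R (N+M) ≤ R N + R M + C` ⇒ the slot's conclusion.
* `ereal_tendsto_of_quasiSuperadditive_resistance` — SUPERADDITIVE line (abstract `D`): positivity +
  `R N + R M - C ≤ R (N+M)` + an eventual lower bound `D N ≥ c > 0` ⇒ the slot's conclusion (Fekete applied
  to `N/c + K₀ - R N`).
* `positiveOrInfiniteLimit_of_feketeSeriesLaw :
    FeketeSeriesLaw.PositiveConductance → FeketeSeriesLaw.QuasiSubadditiveResistance → PositiveOrInfiniteLimit`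
  and `positiveOrInfiniteLimit_of_junctionLocality : JunctionLocality.PositiveConductance →
    JunctionLocality.ConductanceLowerBound → JunctionLocality.SuperadditiveResistance → PositiveOrInfiniteLimit`
  (no `NonBallistic` needed for the slot).  `feketeSeriesLaw_positiveOrInfiniteLimit_of` is the first one typed
  at route `FeketeSeriesLaw`'s verbatim (definitionally equal) copy of the shared slot, so that item 14043
  (`TransferToPositiveOrInfinite`) is `fun _ hP hS => feketeSeriesLaw_positiveOrInfiniteLimit_of hP hS`.

Nothing here closes item 9128: it stays open on `stmt-AtomisticToContinuum-11750` (`PositiveConductance`, M)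
together with EITHER `stmt-AtomisticToContinuum-14041` (`QuasiSubadditiveResistance`, XL) OR items 11748 + 11749
(`SuperadditiveResistance`, `ConductanceLowerBound`, XL); once the `_holds` links exist, one application closes
9128.  Harmonic calibration: `R N` bounded, Fekete limit `ℓ = 0`, slot holds with `⊤` (the top branch below).
-/

noncomputable section

open Filter Topology Set

namespace Summit.AtomisticToContinuum.FouriersLaw.Theorems.PositiveOrInfiniteLimit

/-! ## Fekete's lemma with an additive defect on `{n ≥ 2}` -/

/-- Iterated subadditivity on the index semigroup `{n ≥ 2}`: if `b (n+m) ≤ b n + b m` for `n, m ≥ 2`, then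
`b (m q + r) ≤ q · b m + b r` for `m, r ≥ 2` and every `q` (induction on `q`). [folklore] -/
theorem iterate_subadditive_two {b : ℕ → ℝ}
    (hb : ∀ n m : ℕ, 2 ≤ n → 2 ≤ m → b (n + m) ≤ b n + b m)
    {m r : ℕ} (hm : 2 ≤ m) (hr : 2 ≤ r) (q : ℕ) :
    b (m * q + r) ≤ (q : ℝ) * b m + b r := by
  induction q with
  | zero => simp
  | succ q ih =>
    have hqr : 2 ≤ m * q + r := hr.trans (Nat.le_add_left r (m * q))
    have h1 : b (m + (m * q + r)) ≤ b m + b (m * q + r) := hb m (m * q + r) hm hqr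
    have heq : m * (q + 1) + r = m + (m * q + r) := by ring
    have hmul : ((q : ℝ) + 1) * b m = (q : ℝ) * b m + b m := by ring
    rw [heq]
    push_cast
    linarith [hmul]

/-- The one-scale bound behind Fekete's lemma on `{n ≥ 2}`: if `b` is subadditive there and `m ≥ 2`, then
for some constant `M`, `b n / n ≤ b m / m + M / n` for every `n ≥ 2` (Euclidean division `n = m q + r`
with `2 ≤ r ≤ m + 1`, `b n ≤ q b m + b r`, `q m = n - r`). [folklore] -/
theorem div_le_add_div_of_subadditive_two {b : ℕ → ℝ}
    (hb : ∀ n m : ℕ, 2 ≤ n → 2 ≤ m → b (n + m) ≤ b n + b m) {m : ℕ} (hm : 2 ≤ m) :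
    ∃ M : ℝ, ∀ n : ℕ, 2 ≤ n → b n / (n : ℝ) ≤ b m / (m : ℝ) + M / (n : ℝ) := by
  -- a uniform bound on the finitely many remainders `b r`, `r < m + 2`
  set K : ℝ := ∑ r ∈ Finset.range (m + 2), |b r| with hK_def
  have hK : ∀ r : ℕ, r < m + 2 → b r ≤ K := fun r hr =>
    (le_abs_self _).trans
      (Finset.single_le_sum (f := fun i => |b i|) (fun i _ => abs_nonneg (b i)) (Finset.mem_range.2 hr))
  refine ⟨((m : ℝ) + 1) * |b m / (m : ℝ)| + K, fun n hn => ?_⟩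
  have hm0 : 0 < m := by omega
  have hmpos : (0 : ℝ) < m := by exact_mod_cast hm0
  have hnpos : (0 : ℝ) < n := by exact_mod_cast (show 0 < n by omega)
  -- Euclidean division of `n - 2` by `m`
  have hr2 : 2 ≤ (n - 2) % m + 2 := by omega
  have hrm : (n - 2) % m + 2 < m + 2 := by
    have := Nat.mod_lt (n - 2) hm0
    omega
  have hn_eq : n = m * ((n - 2) / m) + ((n - 2) % m + 2) := by
    have := Nat.div_add_mod (n - 2) m
    omega
  have hbn : b n ≤ (((n - 2) / m : ℕ) : ℝ) * b m + b ((n - 2) % m + 2) := by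
    have := iterate_subadditive_two hb hm hr2 ((n - 2) / m)
    rwa [← hn_eq] at this
  have hn_real : (n : ℝ) = (m : ℝ) * (((n - 2) / m : ℕ) : ℝ) + (((n - 2) % m + 2 : ℕ) : ℝ) := by
    exact_mod_cast hn_eq
  have hR_le : (((n - 2) % m + 2 : ℕ) : ℝ) ≤ (m : ℝ) + 1 := by
    exact_mod_cast (show (n - 2) % m + 2 ≤ m + 1 by omega)
  have hR_nn : (0 : ℝ) ≤ (((n - 2) % m + 2 : ℕ) : ℝ) := Nat.cast_nonneg _
  have hbr : b ((n - 2) % m + 2) ≤ K := hK _ hrm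
  set Q : ℝ := (((n - 2) / m : ℕ) : ℝ) with hQ_def
  set R : ℝ := (((n - 2) % m + 2 : ℕ) : ℝ) with hR_def
  set β : ℝ := b m / (m : ℝ) with hβ_def
  have hbm : b m = (m : ℝ) * β := by
    rw [hβ_def]
    field_simp
  have h1 : Q * b m = ((n : ℝ) - R) * β := by
    rw [hbm, hn_real]
    ring
  have h2 : -(R * β) ≤ R * |β| :=
    (neg_le_abs _).trans_eq (by rw [abs_mul, abs_of_nonneg hR_nn])
  have h3 : R * |β| ≤ ((m : ℝ) + 1) * |β| := mul_le_mul_of_nonneg_right hR_le (abs_nonneg β)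
  have hmain : b n ≤ (n : ℝ) * β + (((m : ℝ) + 1) * |β| + K) := by
    have h4 : b n ≤ ((n : ℝ) - R) * β + K := by
      rw [← h1]
      linarith [hbn, hbr]
    have h5 : ((n : ℝ) - R) * β = (n : ℝ) * β + -(R * β) := by ring
    linarith [h4, h5, h2, h3]
  calc b n / (n : ℝ) ≤ ((n : ℝ) * β + (((m : ℝ) + 1) * |β| + K)) / (n : ℝ) :=
        div_le_div_of_nonneg_right hmain hnpos.le
    _ = β + (((m : ℝ) + 1) * |β| + K) / (n : ℝ) := by
        rw [add_div, mul_div_cancel_left₀ β (ne_of_gt hnpos)]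

/-- **Fekete's lemma with an additive defect on the index semigroup `{n ≥ 2}`.** If
`a (n+m) ≤ a n + a m + C` for all `n, m ≥ 2` and `a n ≥ 0` for `n ≥ 2`, then `a n / n` converges to some
`ℓ ≥ 0` (in fact `ℓ = inf_{n ≥ 2} (a n + C)/n`). Proof: `b := a + C` is subadditive on `{n ≥ 2}` with
`b n / n ≥ -|C|` there; `b n / n ≥ ℓ` for `n ≥ 2` and, for every scale `m ≥ 2`, `b n / n ≤ b m / m + M/n`
(`div_le_add_div_of_subadditive_two`); finally `C/n → 0`. The values `a 0`, `a 1` are unconstrained.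
[folklore] (Fekete 1923; Hammersley 1962 for the defect form) -/
theorem tendsto_div_of_quasiSubadditive_two (a : ℕ → ℝ) (C : ℝ)
    (hsub : ∀ n m : ℕ, 2 ≤ n → 2 ≤ m → a (n + m) ≤ a n + a m + C)
    (hpos : ∀ n : ℕ, 2 ≤ n → 0 ≤ a n) :
    ∃ ℓ : ℝ, 0 ≤ ℓ ∧ Tendsto (fun n : ℕ => a n / (n : ℝ)) atTop (𝓝 ℓ) := by
  -- the subadditive shift `b = a + C`
  set b : ℕ → ℝ := fun n => a n + C with hb_def
  have hb : ∀ n m : ℕ, 2 ≤ n → 2 ≤ m → b (n + m) ≤ b n + b m := by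
    intro n m hn hm
    simp only [hb_def]
    linarith [hsub n m hn hm]
  have hlow : ∀ n : ℕ, 2 ≤ n → -|C| ≤ b n / (n : ℝ) := by
    intro n hn
    have hn' : (2 : ℝ) ≤ n := by exact_mod_cast hn
    have hnpos : (0 : ℝ) < n := by linarith
    rw [le_div_iff₀ hnpos]
    simp only [hb_def]
    have h1 := hpos n hn
    have h2 := neg_abs_le C
    have h3 := abs_nonneg C
    nlinarith
  -- the candidate limit `ℓ = inf_{n ≥ 2} b n / n`
  set S : Set ℝ := (fun n : ℕ => b n / (n : ℝ)) '' {n : ℕ | 2 ≤ n} with hS_def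
  have hSne : S.Nonempty := ⟨_, 2, (le_rfl : 2 ≤ 2), rfl⟩
  have hSbdd : BddBelow S := by
    refine ⟨-|C|, ?_⟩
    rintro x ⟨n, hn, rfl⟩
    exact hlow n hn
  set ℓ := sInf S with hℓ_def
  have hℓ_le : ∀ n : ℕ, 2 ≤ n → ℓ ≤ b n / (n : ℝ) := fun n hn => csInf_le hSbdd ⟨n, hn, rfl⟩
  -- Step 1: `b n / n → ℓ`
  have hb_lim : Tendsto (fun n : ℕ => b n / (n : ℝ)) atTop (𝓝 ℓ) := by
    rw [tendsto_order]
    refine ⟨fun x hx => ?_, fun x hx => ?_⟩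
    · filter_upwards [eventually_ge_atTop 2] with n hn
      exact hx.trans_le (hℓ_le n hn)
    · have hε : 0 < (x - ℓ) / 2 := by linarith
      obtain ⟨y, ⟨m, hm, rfl⟩, hy⟩ :=
        exists_lt_of_csInf_lt hSne (show ℓ < ℓ + (x - ℓ) / 2 by linarith)
      have hm2 : 2 ≤ m := hm
      have hy' : b m / (m : ℝ) < ℓ + (x - ℓ) / 2 := hy
      obtain ⟨M, hM⟩ := div_le_add_div_of_subadditive_two hb hm2
      have hMn : ∀ᶠ n : ℕ in atTop, M / (n : ℝ) < (x - ℓ) / 2 :=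
        (tendsto_const_div_atTop_nhds_zero_nat M).eventually (gt_mem_nhds hε)
      filter_upwards [hMn, eventually_ge_atTop 2] with n hn hn2
      calc b n / (n : ℝ) ≤ b m / (m : ℝ) + M / (n : ℝ) := hM n hn2
        _ < (ℓ + (x - ℓ) / 2) + (x - ℓ) / 2 := add_lt_add hy' hn
        _ = x := by ring
  -- Step 2: `a n / n = b n / n - C / n → ℓ`
  have ha_lim : Tendsto (fun n : ℕ => a n / (n : ℝ)) atTop (𝓝 ℓ) := by
    have h := hb_lim.sub (tendsto_const_div_atTop_nhds_zero_nat C)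
    rw [sub_zero] at h
    refine h.congr fun n => ?_
    simp only [hb_def]
    ring
  -- Step 3: `ℓ ≥ 0`
  have hℓ0 : 0 ≤ ℓ :=
    ge_of_tendsto ha_lim <| by
      filter_upwards [eventually_ge_atTop 2] with n hn
      exact div_nonneg (hpos n hn) (Nat.cast_nonneg n)
  exact ⟨ℓ, hℓ0, ha_lim⟩

/-! ## From the Fekete limit of `R N / N` to the `EReal` limit of `D N` -/

/-- **The `EReal` step.** If `D N > 0` for `N ≥ 2` and the normalised resistances `((N-1)/D N)/N` converge
to some `ℓ ≥ 0`, then `D N` converges in `EReal` to a limit `ℓ' > 0`: `D N = ((N-1)/N)/(R N/N)` for `N ≥ 2`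
with `(N-1)/N → 1`; if `ℓ > 0` then `D N → 1/ℓ` (a real positive limit, the coercion `ℝ → EReal` being
continuous); if `ℓ = 0` then `D N ≥ (R N/N)⁻¹/2 → +∞`, i.e. `D N → ⊤` (`EReal.tendsto_nhds_top_iff_real`).
[folklore] -/
theorem ereal_tendsto_of_tendsto_resistance_div (D : ℕ → ℝ) {ℓ : ℝ}
    (hpos : ∀ N : ℕ, 2 ≤ N → 0 < D N) (hℓ0 : 0 ≤ ℓ)
    (hlim : Tendsto (fun N : ℕ => ((N : ℝ) - 1) / D N / (N : ℝ)) atTop (𝓝 ℓ)) :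
    ∃ ℓ' : EReal, 0 < ℓ' ∧ Tendsto (fun N : ℕ => ((D N : ℝ) : EReal)) atTop (𝓝 ℓ') := by
  set g : ℕ → ℝ := fun N => ((N : ℝ) - 1) / D N / (N : ℝ) with hg_def
  -- `D N = ((N-1)/N) / g N` for `N ≥ 2`
  have hid : ∀ N : ℕ, 2 ≤ N → D N = (((N : ℝ) - 1) / (N : ℝ)) / g N := by
    intro N hN
    have hD : D N ≠ 0 := (hpos N hN).ne'
    have hN0 : (N : ℝ) ≠ 0 := by exact_mod_cast (show N ≠ 0 by omega)
    have hN1 : (N : ℝ) - 1 ≠ 0 := by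
      have : (2 : ℝ) ≤ N := by exact_mod_cast hN
      linarith
    simp only [hg_def]
    field_simp
  -- `(N-1)/N → 1`, `(N-1)/N ≥ 1/2` and `g N > 0` for `N ≥ 2`
  have hone : Tendsto (fun N : ℕ => ((N : ℝ) - 1) / (N : ℝ)) atTop (𝓝 1) := by
    have h : Tendsto (fun N : ℕ => 1 - 1 / (N : ℝ)) atTop (𝓝 (1 - 0)) :=
      tendsto_const_nhds.sub tendsto_one_div_atTop_nhds_zero_nat
    rw [sub_zero] at h
    refine h.congr' ?_
    filter_upwards [eventually_ge_atTop 1] with N hN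
    have hN0 : (N : ℝ) ≠ 0 := by exact_mod_cast (show N ≠ 0 by omega)
    field_simp
  have hhalf : ∀ N : ℕ, 2 ≤ N → (1 / 2 : ℝ) ≤ ((N : ℝ) - 1) / (N : ℝ) := by
    intro N hN
    have hNpos : (0 : ℝ) < N := by exact_mod_cast (show 0 < N by omega)
    have h2 : (2 : ℝ) ≤ N := by exact_mod_cast hN
    rw [le_div_iff₀ hNpos]
    linarith
  have hgpos : ∀ N : ℕ, 2 ≤ N → 0 < g N := by
    intro N hN
    have hNpos : (0 : ℝ) < N := by exact_mod_cast (show 0 < N by omega)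
    have hN1 : (0 : ℝ) < (N : ℝ) - 1 := by
      have : (2 : ℝ) ≤ N := by exact_mod_cast hN
      linarith
    exact div_pos (div_pos hN1 (hpos N hN)) hNpos
  rcases hℓ0.eq_or_lt with hℓ | hℓ
  · -- `ℓ = 0`: a perfect conductor in the limit, `D N → +∞`
    have hlim0 : Tendsto g atTop (𝓝 0) := by rwa [← hℓ] at hlim
    have hg : Tendsto g atTop (𝓝[>] 0) := by
      refine tendsto_nhdsWithin_iff.2 ⟨hlim0, ?_⟩
      filter_upwards [eventually_ge_atTop 2] with N hN
      exact hgpos N hN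
    have hinv : Tendsto (fun N : ℕ => (g N)⁻¹) atTop atTop := hg.inv_tendsto_nhdsGT_zero
    have hD : Tendsto D atTop atTop := by
      refine tendsto_atTop_mono' atTop ?_ (hinv.const_mul_atTop (by norm_num : (0 : ℝ) < 1 / 2))
      filter_upwards [eventually_ge_atTop 2] with N hN
      rw [hid N hN]
      calc (1 / 2 : ℝ) * (g N)⁻¹ ≤ (((N : ℝ) - 1) / (N : ℝ)) * (g N)⁻¹ :=
            mul_le_mul_of_nonneg_right (hhalf N hN) (inv_pos.2 (hgpos N hN)).le
        _ = (((N : ℝ) - 1) / (N : ℝ)) / g N := (div_eq_mul_inv _ _).symm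
    refine ⟨⊤, EReal.zero_lt_top, EReal.tendsto_nhds_top_iff_real.2 fun x => ?_⟩
    filter_upwards [hD.eventually_gt_atTop x] with N hN
    exact EReal.coe_lt_coe_iff.2 hN
  · -- `ℓ > 0`: a real positive limit `1/ℓ`
    have hD : Tendsto D atTop (𝓝 (1 / ℓ)) := by
      refine (hone.div hlim hℓ.ne').congr' ?_
      filter_upwards [eventually_ge_atTop 2] with N hN
      exact (hid N hN).symm
    exact ⟨((1 / ℓ : ℝ) : EReal), EReal.coe_pos.2 (one_div_pos.2 hℓ),
      (continuous_coe_real_ereal.tendsto _).comp hD⟩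

/-! ## The two series laws for the resistance -/

/-- **Subadditive line: series law with bounded junction defect + positive conductance ⇒ positive-or-infinite
limit.** For an abstract sequence `D` with `D N > 0` (`N ≥ 2`) whose resistances `R N := (N-1)/D N` satisfy
`R (N+M) ≤ R N + R M + C` (`N, M ≥ 2`), `D N` converges in `EReal` to some `ℓ' > 0` (Fekete on `{N ≥ 2}` for
`R`, then `ereal_tendsto_of_tendsto_resistance_div`). [folklore] -/
theorem ereal_tendsto_of_quasiSubadditive_resistance (D : ℕ → ℝ) (C : ℝ)
    (hpos : ∀ N : ℕ, 2 ≤ N → 0 < D N)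
    (hsub : ∀ N M : ℕ, 2 ≤ N → 2 ≤ M →
      ((N + M - 1 : ℕ) : ℝ) / D (N + M) ≤ ((N - 1 : ℕ) : ℝ) / D N + ((M - 1 : ℕ) : ℝ) / D M + C) :
    ∃ ℓ : EReal, 0 < ℓ ∧ Tendsto (fun N : ℕ => ((D N : ℝ) : EReal)) atTop (𝓝 ℓ) := by
  -- the resistances `a N = (N-1)/D N`
  set a : ℕ → ℝ := fun N => ((N - 1 : ℕ) : ℝ) / D N with ha_def
  have ha_sub : ∀ n m : ℕ, 2 ≤ n → 2 ≤ m → a (n + m) ≤ a n + a m + C := fun n m hn hm => by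
    simpa only [ha_def] using hsub n m hn hm
  have ha_pos : ∀ n : ℕ, 2 ≤ n → 0 ≤ a n := fun n hn =>
    div_nonneg (Nat.cast_nonneg _) (hpos n hn).le
  obtain ⟨ℓ, hℓ0, hlim⟩ := tendsto_div_of_quasiSubadditive_two a C ha_sub ha_pos
  refine ereal_tendsto_of_tendsto_resistance_div D hpos hℓ0 (hlim.congr' ?_)
  filter_upwards [eventually_ge_atTop 1] with N hN
  simp only [ha_def]
  rw [Nat.cast_sub hN, Nat.cast_one]

/-- **Superadditive line: superadditivity up to a constant + an eventual Ohmic lower bound + positive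
conductance ⇒ positive-or-infinite limit.** For an abstract sequence `D` with `D N > 0` (`N ≥ 2`),
`D N ≥ c > 0` for `N ≥ N₁`, and resistances `R N := (N-1)/D N` with `R N + R M - C ≤ R (N+M)` (`N, M ≥ 2`),
`D N` converges in `EReal` to some `ℓ' > 0`. Proof: `R N ≤ N/c + K₀` for `N ≥ 2` (`K₀` absorbing the finitely
many `N < N₁`), so `a N := N/c + K₀ - R N ≥ 0` is quasi-SUBadditive with defect `C - K₀`; Fekete gives
`a N / N → ℓₐ`, hence `R N / N → 1/c - ℓₐ =: ℓ ≥ 0`, and `ereal_tendsto_of_tendsto_resistance_div` concludes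
(no non-ballisticity is needed: `ℓ = 0` is the `⊤` branch). [folklore] -/
theorem ereal_tendsto_of_quasiSuperadditive_resistance (D : ℕ → ℝ) (C c : ℝ) (N₁ : ℕ) (hc : 0 < c)
    (hpos : ∀ N : ℕ, 2 ≤ N → 0 < D N) (hlow : ∀ N : ℕ, N₁ ≤ N → c ≤ D N)
    (hsup : ∀ N M : ℕ, 2 ≤ N → 2 ≤ M →
      ((N : ℝ) - 1) / D N + ((M : ℝ) - 1) / D M - C ≤ ((N : ℝ) + (M : ℝ) - 1) / D (N + M)) :
    ∃ ℓ : EReal, 0 < ℓ ∧ Tendsto (fun N : ℕ => ((D N : ℝ) : EReal)) atTop (𝓝 ℓ) := by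
  set R : ℕ → ℝ := fun N => ((N : ℝ) - 1) / D N with hR_def
  -- `R N ≤ N/c + K₀` for `N ≥ 2`
  set K₀ : ℝ := ∑ N ∈ Finset.range N₁, |R N| with hK₀_def
  have hK₀ : 0 ≤ K₀ := Finset.sum_nonneg fun i _ => abs_nonneg (R i)
  have hRle : ∀ N : ℕ, 2 ≤ N → R N ≤ (N : ℝ) / c + K₀ := by
    intro N hN
    have hNc : 0 ≤ (N : ℝ) / c := div_nonneg (Nat.cast_nonneg N) hc.le
    rcases lt_or_ge N N₁ with h | h
    · calc R N ≤ |R N| := le_abs_self _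
        _ ≤ K₀ := Finset.single_le_sum (f := fun i => |R i|) (fun i _ => abs_nonneg (R i))
            (Finset.mem_range.2 h)
        _ ≤ (N : ℝ) / c + K₀ := by linarith
    · have hD : c ≤ D N := hlow N h
      have hN1 : (0 : ℝ) ≤ (N : ℝ) - 1 := by
        have : (2 : ℝ) ≤ N := by exact_mod_cast hN
        linarith
      calc R N = ((N : ℝ) - 1) / D N := rfl
        _ ≤ ((N : ℝ) - 1) / c := div_le_div_of_nonneg_left hN1 hc hD
        _ ≤ (N : ℝ) / c := div_le_div_of_nonneg_right (by linarith) hc.le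
        _ ≤ (N : ℝ) / c + K₀ := by linarith
  -- the quasi-subadditive complement `a N = N/c + K₀ - R N ≥ 0`
  set a : ℕ → ℝ := fun N => (N : ℝ) / c + K₀ - R N with ha_def
  have ha_pos : ∀ n : ℕ, 2 ≤ n → 0 ≤ a n := fun n hn => by
    simp only [ha_def]
    linarith [hRle n hn]
  have ha_sub : ∀ n m : ℕ, 2 ≤ n → 2 ≤ m → a (n + m) ≤ a n + a m + (C - K₀) := by
    intro n m hn hm
    have h := hsup n m hn hm
    have hRnm : R (n + m) = ((n : ℝ) + (m : ℝ) - 1) / D (n + m) := by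
      simp only [hR_def, Nat.cast_add]
    simp only [ha_def, Nat.cast_add]
    rw [hRnm]
    rw [(rfl : R n = ((n : ℝ) - 1) / D n), (rfl : R m = ((m : ℝ) - 1) / D m)]
    linarith [add_div (n : ℝ) (m : ℝ) c]
  obtain ⟨ℓa, -, hlim⟩ := tendsto_div_of_quasiSubadditive_two a (C - K₀) ha_sub ha_pos
  -- `R N / N = 1/c + K₀/N - a N/N → 1/c - ℓa =: ℓ ≥ 0`
  have hRlim : Tendsto (fun N : ℕ => ((N : ℝ) - 1) / D N / (N : ℝ)) atTop (𝓝 (1 / c + 0 - ℓa)) := by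
    have h := ((tendsto_const_nhds (x := 1 / c)).add (tendsto_const_div_atTop_nhds_zero_nat K₀)).sub hlim
    refine h.congr' ?_
    filter_upwards [eventually_ge_atTop 1] with N hN
    have hN0 : (N : ℝ) ≠ 0 := by exact_mod_cast (show N ≠ 0 by omega)
    simp only [ha_def, hR_def]
    field_simp
    ring
  have hℓ0 : 0 ≤ 1 / c + 0 - ℓa :=
    ge_of_tendsto hRlim <| by
      filter_upwards [eventually_ge_atTop 2] with N hN
      have hN1 : (0 : ℝ) ≤ (N : ℝ) - 1 := by
        have : (2 : ℝ) ≤ N := by exact_mod_cast hN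
        linarith
      exact div_nonneg (div_nonneg hN1 (hpos N hN).le) (Nat.cast_nonneg N)
  exact ereal_tendsto_of_tendsto_resistance_div D hpos hℓ0 hRlim

/-! ## The import slot from the cruxes of routes `FeketeSeriesLaw` and `JunctionLocality` -/

open Summit.AtomisticToContinuum.FouriersLaw.Theses in
/-- **`PositiveConductance → QuasiSubadditiveResistance → PositiveOrInfiniteLimit`** (route decls of
`FeketeSeriesLaw` by name; conclusion the route decl of `BondHeatUncertainty`). Fix the parameters, the
weak-NESS uniqueness hypothesis, a steady-state family `μ`, `T > 0` and response coefficients `D`; the two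
cruxes give `D N > 0` (`N ≥ 2`) and the series law with bounded junction defect for `(N-1)/D N`, and
`ereal_tendsto_of_quasiSubadditive_resistance` concludes. This is the supply line named in the slot's route
text ("FeketeResistance minus its crux (B)"); it does not close item 9128, which waits on the two cruxes.
[folklore] -/
theorem positiveOrInfiniteLimit_of_feketeSeriesLaw
    (hP : FeketeSeriesLaw.PositiveConductance) (hS : FeketeSeriesLaw.QuasiSubadditiveResistance) :
    BondHeatUncertainty.PositiveOrInfiniteLimit := by
  intro ω₂ lam β γ hω hl hβ hγ huniq μ hμ T hT D hD
  obtain ⟨C, hC⟩ := hS ω₂ lam β γ hω hl hβ hγ huniq μ hμ T hT D hD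
  exact ereal_tendsto_of_quasiSubadditive_resistance D C
    (hP ω₂ lam β γ hω hl hβ hγ huniq μ hμ T hT D hD) hC

open Summit.AtomisticToContinuum.FouriersLaw.Theses in
/-- The same transfer typed at route `FeketeSeriesLaw`'s verbatim copy of the shared slot (the two decls
`BondHeatUncertainty.PositiveOrInfiniteLimit` and `FeketeSeriesLaw.PositiveOrInfiniteLimit` are syntactically
identical, hence definitionally equal); with it, item `TransferToPositiveOrInfinite` (14043) of that route is
`fun _ hP hS => feketeSeriesLaw_positiveOrInfiniteLimit_of hP hS`. [folklore] -/
theorem feketeSeriesLaw_positiveOrInfiniteLimit_of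
    (hP : FeketeSeriesLaw.PositiveConductance) (hS : FeketeSeriesLaw.QuasiSubadditiveResistance) :
    FeketeSeriesLaw.PositiveOrInfiniteLimit :=
  positiveOrInfiniteLimit_of_feketeSeriesLaw hP hS

open Summit.AtomisticToContinuum.FouriersLaw.Theses in
/-- **`PositiveConductance → ConductanceLowerBound → SuperadditiveResistance → PositiveOrInfiniteLimit`**
(route decls of `JunctionLocality` by name; conclusion the route decl of `BondHeatUncertainty`): the
superadditive supply line ("SuperadditiveJunction (A)+(C)"), WITHOUT the non-ballisticity crux (B) — for
the slot a bounded resistance simply means `D N → ⊤`. Fix parameters, uniqueness, `μ`, `T`, `D`; positivity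
(`N ≥ 2`), the eventual lower bound `D N ≥ c > 0` and `R N + R M - C ≤ R (N+M)` are exactly the hypotheses
of `ereal_tendsto_of_quasiSuperadditive_resistance`. Does not close item 9128 (waits on 11748, 11749, 11750).
[folklore] -/
theorem positiveOrInfiniteLimit_of_junctionLocality
    (hP : JunctionLocality.PositiveConductance) (hL : JunctionLocality.ConductanceLowerBound)
    (hA : JunctionLocality.SuperadditiveResistance) :
    BondHeatUncertainty.PositiveOrInfiniteLimit := by
  intro ω₂ lam β γ hω hl hβ hγ huniq μ hμ T hT D hD
  have hpos := hP ω₂ lam β γ hω hl hβ hγ huniq μ hμ T hT D hD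
  obtain ⟨c, hc, N₁, hN₁⟩ := hL ω₂ lam β γ hω hl hβ hγ huniq μ hμ T hT D hD
  obtain ⟨C, hC⟩ := hA ω₂ lam β γ hω hl hβ hγ huniq μ hμ T hT D hD hpos
  exact ereal_tendsto_of_quasiSuperadditive_resistance D C c N₁ hc hpos hN₁ hC

end Summit.AtomisticToContinuum.FouriersLaw.Theorems.PositiveOrInfiniteLimit

end
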